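import Summits.AtomisticToContinuum.Crystallization.Theorems.OverbindingBudgetAffineFarSmoothSeam
import Summits.AtomisticToContinuum.Crystallization.Theorems.OverbindingBudgetPatchContinuity

/-!
# Overbinding budget — slot Z of the 31280 record, leaf Zr‴b `NormalCorePricing (1/25)`, part 2: Lipschitz tools for the smooth core

The analytic half of the proof of `NormalCorePricing (1/25)`: the smooth-core summand `(1 − tailW ν r) · V(r)` moves by `O(η)` when the
bond length `r ≥ 9/10` and the normalising nearest distance `ν ≥ 9/10` both move by `≤ η` (`core_summand_estimate`, constant `1.5·10⁶`).

* §1 the clamped Bernstein smoothstep `sigma15` is LIPSCHITZ with the crude algebraic constant `15 · 2¹⁵ = 491520`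
  (`sigma15_eq_sum_clamp`: `σ(t) = Σ_{k=8}^{15} C(15,k) uᵏ(1−u)^{15−k}` at the `1`-Lipschitz clamp `u = max 0 (min t 1)`; each Bernstein
  term is `15`-Lipschitz on `[0,1]`; `Σ_k C(15,k) ≤ 2¹⁵`); hence `tailW` is Lipschitz in the ratio `r/ν` (`abs_tailW_sub_tailW_le`).
* §2 `|V| ≤ 1` on `[9/10, ∞)`, the Literature Lipschitz bound `abs_lennardJones_sub_le` at `m = 9/10`, and the summand estimate.
* §3 sign of the reference core summand: `coreTerm ≤ 0` once `a₀‖B p‖ ≥ 47/50` (`V ≤ 0` there, weight `≥ 0`).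

[this file: Summit.AtomisticToContinuum.Crystallization, slot Z of the 31280 record, leaf Zr‴b, part 2]
-/

namespace Summit.AtomisticToContinuum.Crystallization.Theorems.OverbindingBudgetAffineFarSmoothSplit

open Literature.MathematicalPhysics.StatisticalMechanics

/-! ## §1  The smoothstep is Lipschitz -/

/-- Powers are `n`-Lipschitz on `[0,1]`. [Mathlib `abs_pow_sub_pow_le`; this file] -/
theorem abs_pow_sub_pow_le_of_unit {a a' : ℝ} (ha : 0 ≤ a) (ha1 : a ≤ 1) (ha' : 0 ≤ a') (ha1' : a' ≤ 1) (n : ℕ) :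
    |a ^ n - a' ^ n| ≤ n * |a - a'| := by
  have h1 := abs_pow_sub_pow_le a a' n
  have hmax : max |a| |a'| ≤ 1 := max_le (by rwa [abs_of_nonneg ha]) (by rwa [abs_of_nonneg ha'])
  have hmax0 : 0 ≤ max |a| |a'| := (abs_nonneg a).trans (le_max_left _ _)
  have h2 : max |a| |a'| ^ (n - 1) ≤ 1 := pow_le_one₀ hmax0 hmax
  calc |a ^ n - a' ^ n| ≤ |a - a'| * n * max |a| |a'| ^ (n - 1) := h1
    _ ≤ |a - a'| * n * 1 := mul_le_mul_of_nonneg_left h2 (by positivity)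
    _ = n * |a - a'| := by ring

/-- A Bernstein term `uᵏ(1−u)ᵐ` is `(k + m)`-Lipschitz on `[0,1]`. [this file] -/
theorem abs_bernsteinTerm_sub_le {u u' : ℝ} (hu0 : 0 ≤ u) (hu1 : u ≤ 1) (hu0' : 0 ≤ u') (hu1' : u' ≤ 1) (k m : ℕ) :
    |u ^ k * (1 - u) ^ m - u' ^ k * (1 - u') ^ m| ≤ (k + m) * |u - u'| := by
  have ha := abs_pow_sub_pow_le_of_unit hu0 hu1 hu0' hu1' k
  have hb : |(1 - u) ^ m - (1 - u') ^ m| ≤ m * |u - u'| := by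
    have := abs_pow_sub_pow_le_of_unit (sub_nonneg.2 hu1) (by linarith) (sub_nonneg.2 hu1') (by linarith) m
    rwa [show (1 - u) - (1 - u') = -(u - u') by ring, abs_neg] at this
  have e : u ^ k * (1 - u) ^ m - u' ^ k * (1 - u') ^ m =
      (u ^ k - u' ^ k) * (1 - u) ^ m + u' ^ k * ((1 - u) ^ m - (1 - u') ^ m) := by ring
  rw [e]
  have h1 : (1 - u) ^ m ≤ 1 := pow_le_one₀ (sub_nonneg.2 hu1) (by linarith)
  have h2 : u' ^ k ≤ 1 := pow_le_one₀ hu0' hu1'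
  calc |(u ^ k - u' ^ k) * (1 - u) ^ m + u' ^ k * ((1 - u) ^ m - (1 - u') ^ m)|
      ≤ |(u ^ k - u' ^ k) * (1 - u) ^ m| + |u' ^ k * ((1 - u) ^ m - (1 - u') ^ m)| := abs_add_le _ _
    _ = |u ^ k - u' ^ k| * (1 - u) ^ m + u' ^ k * |(1 - u) ^ m - (1 - u') ^ m| := by
        rw [abs_mul, abs_mul, abs_of_nonneg (pow_nonneg (sub_nonneg.2 hu1) m), abs_of_nonneg (pow_nonneg hu0' k)]
    _ ≤ |u ^ k - u' ^ k| * 1 + 1 * |(1 - u) ^ m - (1 - u') ^ m| :=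
        add_le_add (mul_le_mul_of_nonneg_left h1 (abs_nonneg _)) (mul_le_mul_of_nonneg_right h2 (abs_nonneg _))
    _ ≤ k * |u - u'| + m * |u - u'| := by linarith
    _ = (k + m) * |u - u'| := by ring

/-- **Bernstein form at the clamp**: `σ(t) = Σ_{k=8}^{15} C(15,k) uᵏ (1−u)^{15−k}` with `u = max 0 (min t 1)` — the sum is `0` at `u = 0`
(every `k ≥ 8 > 0`) and `1` at `u = 1` (only `k = 15` survives). [this file] -/
theorem sigma15_eq_sum_clamp (t : ℝ) : sigma15 t =
    ∑ k ∈ Finset.Icc 8 15, (Nat.choose 15 k : ℝ) * (max 0 (min t 1)) ^ k * (1 - max 0 (min t 1)) ^ (15 - k) := by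
  unfold sigma15
  split_ifs with h0 h1
  · have hu : max 0 (min t 1) = 0 := max_eq_left ((min_le_left _ _).trans h0)
    rw [hu]
    symm
    exact Finset.sum_eq_zero fun k hk => by
      rw [Finset.mem_Icc] at hk
      rw [zero_pow (by omega)]; ring
  · have hu : max 0 (min t 1) = 1 := by rw [min_eq_right h1, max_eq_right zero_le_one]
    rw [hu, Finset.sum_eq_single_of_mem 15 (by rw [Finset.mem_Icc]; omega) fun k hk hne => by
      rw [Finset.mem_Icc] at hk
      rw [sub_self, zero_pow (by omega)]; ring]
    norm_num
  · push Not at h0 h1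
    have hu : max 0 (min t 1) = t := by rw [min_eq_left h1.le, max_eq_right h0.le]
    rw [hu]

/-- **The smoothstep is Lipschitz**: `|σ(t) − σ(t')| ≤ 491520 · |t − t'|` (`491520 = 15 · 2¹⁵`; crude, algebraic). [this file] -/
theorem abs_sigma15_sub_sigma15_le (t t' : ℝ) : |sigma15 t - sigma15 t'| ≤ 491520 * |t - t'| := by
  rw [sigma15_eq_sum_clamp t, sigma15_eq_sum_clamp t', ← Finset.sum_sub_distrib]
  set u := max 0 (min t 1) with hu_def
  set u' := max 0 (min t' 1) with hu'_def
  have hu0 : 0 ≤ u := le_max_left _ _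
  have hu1 : u ≤ 1 := max_le zero_le_one (min_le_right _ _)
  have hu0' : 0 ≤ u' := le_max_left _ _
  have hu1' : u' ≤ 1 := max_le zero_le_one (min_le_right _ _)
  have hcl : |u - u'| ≤ |t - t'| := by
    have h1 := abs_max_sub_max_le_max (0 : ℝ) (min t 1) 0 (min t' 1)
    have h2 := abs_min_sub_min_le_max t 1 t' 1
    rw [sub_self, abs_zero] at h1 h2
    rw [max_eq_right (abs_nonneg (min t 1 - min t' 1))] at h1
    rw [max_eq_left (abs_nonneg (t - t'))] at h2
    exact h1.trans h2
  have hsum : ∑ k ∈ Finset.Icc 8 15, (Nat.choose 15 k : ℝ) ≤ 2 ^ 15 := by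
    have h1 : ∑ k ∈ Finset.Icc 8 15, (Nat.choose 15 k : ℝ) ≤ ∑ k ∈ Finset.range (15 + 1), (Nat.choose 15 k : ℝ) :=
      Finset.sum_le_sum_of_subset_of_nonneg
        (fun k hk => by rw [Finset.mem_Icc] at hk; rw [Finset.mem_range]; omega) fun _ _ _ => Nat.cast_nonneg _
    have h2 : ∑ k ∈ Finset.range (15 + 1), (Nat.choose 15 k : ℝ) = 2 ^ 15 := by exact_mod_cast Nat.sum_range_choose 15
    linarith
  calc |∑ k ∈ Finset.Icc 8 15, ((Nat.choose 15 k : ℝ) * u ^ k * (1 - u) ^ (15 - k) -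
          (Nat.choose 15 k : ℝ) * u' ^ k * (1 - u') ^ (15 - k))|
      ≤ ∑ k ∈ Finset.Icc 8 15, |(Nat.choose 15 k : ℝ) * u ^ k * (1 - u) ^ (15 - k) -
          (Nat.choose 15 k : ℝ) * u' ^ k * (1 - u') ^ (15 - k)| := Finset.abs_sum_le_sum_abs _ _
    _ ≤ ∑ k ∈ Finset.Icc 8 15, (Nat.choose 15 k : ℝ) * (15 * |u - u'|) := Finset.sum_le_sum fun k hk => by
        rw [Finset.mem_Icc] at hk
        rw [show (Nat.choose 15 k : ℝ) * u ^ k * (1 - u) ^ (15 - k) - (Nat.choose 15 k : ℝ) * u' ^ k * (1 - u') ^ (15 - k) =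
          (Nat.choose 15 k : ℝ) * (u ^ k * (1 - u) ^ (15 - k) - u' ^ k * (1 - u') ^ (15 - k)) by ring, abs_mul,
          abs_of_nonneg (Nat.cast_nonneg _)]
        refine mul_le_mul_of_nonneg_left ?_ (Nat.cast_nonneg _)
        have h := abs_bernsteinTerm_sub_le hu0 hu1 hu0' hu1' k (15 - k)
        have e : ((k : ℝ) + ((15 - k : ℕ) : ℝ)) = 15 := by rw [Nat.cast_sub hk.2]; push_cast; ring
        rw [e] at h
        exact h
    _ = (∑ k ∈ Finset.Icc 8 15, (Nat.choose 15 k : ℝ)) * (15 * |u - u'|) := by rw [Finset.sum_mul]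
    _ ≤ 2 ^ 15 * (15 * |u - u'|) := mul_le_mul_of_nonneg_right hsum (by positivity)
    _ = 491520 * |u - u'| := by ring
    _ ≤ 491520 * |t - t'| := mul_le_mul_of_nonneg_left hcl (by norm_num)

/-- **The tail weight is Lipschitz in the ratio**: `|tailW ν r − tailW ν' r'| ≤ 491520 · (10/43) · |r/ν − r'/ν'|`. [this file] -/
theorem abs_tailW_sub_tailW_le (ν r ν' r' : ℝ) :
    |tailW ν r - tailW ν' r'| ≤ 491520 * (10 / 43) * |r / ν - r' / ν'| := by
  unfold tailW
  refine (abs_sigma15_sub_sigma15_le _ _).trans (le_of_eq ?_)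
  rw [show (r / ν - 9 / 2) / (43 / 10) - (r' / ν' - 9 / 2) / (43 / 10) = 10 / 43 * (r / ν - r' / ν') by ring, abs_mul,
    abs_of_pos (by norm_num : (0 : ℝ) < 10 / 43)]
  ring

/-! ## §2  The smooth-core summand moves by `O(η)` -/

/-- `|V(r)| ≤ 1` for `r ≥ 9/10` (`−1/12 ≤ V ≤ (1/12) r⁻¹² ≤ (1/12)(10/9)¹²`). [this file] -/
theorem abs_lennardJones_le_one_of_ge {r : ℝ} (hr : 9 / 10 ≤ r) : |lennardJones r| ≤ 1 := by
  rw [abs_le]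
  refine ⟨by linarith [neg_one_div_le_lennardJones r], ?_⟩
  have hr0 : 0 < r := by linarith
  have hi : r⁻¹ ≤ 10 / 9 := by rw [inv_le_comm₀ hr0 (by norm_num)]; norm_num; exact hr
  have hi0 : 0 ≤ r⁻¹ := inv_nonneg.mpr hr0.le
  have h6 : (r⁻¹) ^ 6 ≤ (10 / 9 : ℝ) ^ 6 := pow_le_pow_left₀ hi0 hi 6
  have h60 : 0 ≤ (r⁻¹) ^ 6 := pow_nonneg hi0 6
  unfold lennardJones
  have e : (r⁻¹) ^ 12 = ((r⁻¹) ^ 6) ^ 2 := by ring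
  rw [e]
  nlinarith

/-- **Summand estimate.**  For normalising distances `ν, ν' ≥ 9/10` and bond lengths `r, r' ≥ 9/10` with `r' ≤ 10 ν'`, `|r − r'| ≤ η`,
`|ν − ν'| ≤ η`: `|(1 − tailW ν r) V(r) − (1 − tailW ν' r') V(r')| ≤ 1.5·10⁶ · η`.  (`|ΔV| ≤ 7η` by `abs_lennardJones_sub_le` at `m = 9/10`;
`|Δ tailW| ≤ 491520·(10/43)·|r/ν − r'/ν'|` with `|r/ν − r'/ν'| ≤ (110/9)·η/… ≤ 12.3 η`; `|V| ≤ 1`, weights in `[0,1]`.) [this file] -/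
theorem core_summand_estimate {ν ν' r r' η : ℝ} (hν : 9 / 10 ≤ ν) (hν' : 9 / 10 ≤ ν') (hr : 9 / 10 ≤ r) (hr' : 9 / 10 ≤ r')
    (hr'ν : r' ≤ 10 * ν') (hrr : |r - r'| ≤ η) (hνν : |ν - ν'| ≤ η) :
    |(1 - tailW ν r) * lennardJones r - (1 - tailW ν' r') * lennardJones r'| ≤ 1500000 * η := by
  have hη : 0 ≤ η := (abs_nonneg _).trans hrr
  have hν0 : 0 < ν := by linarith
  have hν0' : 0 < ν' := by linarith
  -- the potential difference
  have hV : |lennardJones r - lennardJones r'| ≤ 7 * η := by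
    have h1 := OverbindingBudgetPatchContinuity.abs_lennardJones_sub_le (m := 9 / 10) (by norm_num) hr hr'
    have h2 : ((9 / 10 : ℝ)⁻¹ ^ 13 + (9 / 10 : ℝ)⁻¹ ^ 7) ≤ 7 := by norm_num
    calc |lennardJones r - lennardJones r'| ≤ ((9 / 10 : ℝ)⁻¹ ^ 13 + (9 / 10 : ℝ)⁻¹ ^ 7) * |r - r'| := h1
      _ ≤ 7 * η := mul_le_mul h2 hrr (abs_nonneg _) (by norm_num)
  -- the ratio difference
  have hratio : |r / ν - r' / ν'| ≤ 13 * η := by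
    have e : r / ν - r' / ν' = ((r - r') * ν' + r' * (ν' - ν)) / (ν * ν') := by field_simp; ring
    rw [e, abs_div, abs_of_pos (mul_pos hν0 hν0'), div_le_iff₀ (mul_pos hν0 hν0')]
    have h1 : |(r - r') * ν' + r' * (ν' - ν)| ≤ |r - r'| * ν' + r' * |ν' - ν| := by
      calc |(r - r') * ν' + r' * (ν' - ν)| ≤ |(r - r') * ν'| + |r' * (ν' - ν)| := abs_add_le _ _
        _ = |r - r'| * ν' + r' * |ν' - ν| := by rw [abs_mul, abs_mul, abs_of_pos hν0', abs_of_pos (by linarith : (0 : ℝ) < r')]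
    rw [abs_sub_comm] at hνν
    have h2 : |r - r'| * ν' ≤ η * ν' := mul_le_mul_of_nonneg_right hrr hν0'.le
    have h3 : r' * |ν' - ν| ≤ 10 * ν' * η := mul_le_mul hr'ν hνν (abs_nonneg _) (by linarith)
    have h4 : η * ν' * (9 / 10) ≤ η * ν' * ν := mul_le_mul_of_nonneg_left hν (mul_nonneg hη hν0'.le)
    nlinarith
  -- the weight difference
  have hW : |tailW ν r - tailW ν' r'| ≤ 1486000 * η := by
    have h1 := abs_tailW_sub_tailW_le ν r ν' r'
    nlinarith
  -- assemble
  have hw0 : 0 ≤ 1 - tailW ν r := by linarith [tailW_le_one ν r]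
  have hw1 : 1 - tailW ν r ≤ 1 := by linarith [tailW_nonneg ν r]
  have hVr' := abs_lennardJones_le_one_of_ge hr'
  have e : (1 - tailW ν r) * lennardJones r - (1 - tailW ν' r') * lennardJones r' =
      (1 - tailW ν r) * (lennardJones r - lennardJones r') + (tailW ν' r' - tailW ν r) * lennardJones r' := by ring
  rw [e]
  calc |(1 - tailW ν r) * (lennardJones r - lennardJones r') + (tailW ν' r' - tailW ν r) * lennardJones r'|
      ≤ |(1 - tailW ν r) * (lennardJones r - lennardJones r')| + |(tailW ν' r' - tailW ν r) * lennardJones r'| := abs_add_le _ _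
    _ = (1 - tailW ν r) * |lennardJones r - lennardJones r'| + |tailW ν r - tailW ν' r'| * |lennardJones r'| := by
        rw [abs_mul, abs_mul, abs_of_nonneg hw0, abs_sub_comm (tailW ν' r')]
    _ ≤ 1 * (7 * η) + 1486000 * η * 1 := by
        refine add_le_add (mul_le_mul hw1 hV (abs_nonneg _) zero_le_one) (mul_le_mul hW hVr' (abs_nonneg _) (by positivity))
    _ ≤ 1500000 * η := by nlinarith

/-! ## §3  Sign of the reference core summand -/

/-- **The reference core summand is `≤ 0` beyond `47/50`**: the weight `1 − tailW` is `≥ 0` and `V(r) = (1/12)x² − (1/6)x ≤ 0` for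
`x = r⁻⁶ ≤ (50/47)⁶ < 2`. [this file] -/
theorem coreTerm_nonpos_of_ge {B : EuclideanSpace ℝ (Fin 3) →ₗ[ℝ] EuclideanSpace ℝ (Fin 3)} {a₀ nn : ℝ} {p : EuclideanSpace ℝ (Fin 3)}
    (hr : 47 / 50 ≤ a₀ * ‖B p‖) : coreTerm B a₀ nn p ≤ 0 := by
  unfold coreTerm
  have hV : lennardJones (a₀ * ‖B p‖) ≤ 0 := by
    set r := a₀ * ‖B p‖ with hr_def
    have hr0 : 0 < r := by linarith
    have hi : r⁻¹ ≤ 50 / 47 := by rw [inv_le_comm₀ hr0 (by norm_num)]; norm_num; exact hr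
    have hi0 : 0 ≤ r⁻¹ := inv_nonneg.mpr hr0.le
    have h6 : (r⁻¹) ^ 6 ≤ (50 / 47 : ℝ) ^ 6 := pow_le_pow_left₀ hi0 hi 6
    have h60 : 0 ≤ (r⁻¹) ^ 6 := pow_nonneg hi0 6
    unfold lennardJones
    have e : (r⁻¹) ^ 12 = ((r⁻¹) ^ 6) ^ 2 := by ring
    rw [e]
    nlinarith [mul_nonneg h60 (show (0 : ℝ) ≤ 2 - (r⁻¹) ^ 6 by nlinarith)]
  exact mul_nonpos_of_nonneg_of_nonpos (by linarith [tailW_le_one nn (a₀ * ‖B p‖)]) hV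

end Summit.AtomisticToContinuum.Crystallization.Theorems.OverbindingBudgetAffineFarSmoothSplit
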